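import Summits.RiemannHypothesis.RiemannHypothesis.Theorems.NymanBeurlingVasyuninFiniteIdentity
import Summits.RiemannHypothesis.RiemannHypothesis.Theorems.NymanBeurlingGramAutocorr
import Literature.Analysis.SpecialFunctions.InvSinSqPartialFractions
import HarnessLib

/-!
# RiemannHypothesis / Nyman–Beurling — Vasyunin's formula for the Gram matrix, III: BBLS 2003 Prop. 89 DISCHARGED and
every Gram entry `G_{ab}` in closed form, unconditionally (RH-FREE)

Third of three files (plan in `NymanBeurlingVasyuninLayerCake.lean`).  From the finite master identity
(`Vasyunin.integral_fract_mul_fract_eq`) we pass to the limit `M → ∞` with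

* the cotangent partial fractions on `(0,1)`: `Σ_{n<M} (1/(n+x) − 1/(n+1−x)) → π cot(πx)`
  (`tendsto_sum_one_div_sub_one_div`, from `Literature.Analysis.SpecialFunctions.hasSum_pi_mul_cot_sub_inv`, i.e.
  Mathlib's `cot_series_rep'`);
* Stirling in the form `N log N − log N! = N − ½ log(2N) − log s_N`, `s_N → √π` (`Stirling.stirlingSeq`);
* `H_{nM−1} − log(nM) → γ` (`Real.tendsto_harmonic_sub_log_add_one`);

obtaining **`∫_0^∞ {px}{qx} x⁻² dx = ((q−p)/2)(log p − log q) + ((p+q)/2)(log 2π − γ) − (π/2)(V(p,q) + V(q,p))`**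
(`integral_Ioi_fract_mul_fract_div_sq`; integrability `integrableOn_fract_mul_fract_div_sq`), and with
`A(p/q) = q⁻¹ ∫_0^∞ {px}{qx} x⁻² dx` (`fractAutocorr_div_eq`, substitution `t = qx`):

* **`bbls2003_prop89_holds : BBLS2003_prop89`** — for coprime positive `p, q`, `λ = p/q`,
  `A(λ) = (1−λ)/2 · log λ + (λ+1)/2 · (log 2π − γ) − (π/(2q)) (V(p,q) + V(q,p))` (Vasyunin 1996; BBLS 2003 Prop. 89);
* **`nbGram_eq_vasyunin`** — `NymanBeurlingGramAutocorr.nbGram_eq_vasyunin_of` with its hypothesis discharged: every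
  entry `G_{ab} = A(a/b)/a` of the Nyman–Beurling Gram matrix (the object lineages A / R / C2 of DATA.md §L certify) is a
  kernel closed form.

RH-FREE [rh-li-eng-3 g4]: classical analysis; a closed form for a Gram matrix says nothing about `d_N → 0`; nothing here
bears on the truth of RH.
-/

noncomputable section

-- D-0017: `Summit.<S>.<S>.…` is the designed namespace of a single-problem summit.
set_option linter.dupNamespace false

open MeasureTheory Set

namespace Summit.RiemannHypothesis.RiemannHypothesis.Theorems.NbTheory

open Literature.NumberTheory.LFunctions

namespace Vasyunin

/-! ## Step 7: the limits -/

/-- The cotangent partial fractions on `(0,1)`: `Σ_{n<M} (1/(n+x) − 1/(n+1−x)) → π cot(πx)`. -/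
theorem tendsto_sum_one_div_sub_one_div {x : ℝ} (hx0 : 0 < x) (hx1 : x < 1) :
    Filter.Tendsto (fun M : ℕ => ∑ n ∈ Finset.range M, (1 / ((n : ℝ) + x) - 1 / ((n : ℝ) + 1 - x)))
      Filter.atTop (nhds (Real.pi * Real.cot (Real.pi * x))) := by
  have hxZ : ∀ n : ℤ, x ≠ n := by
    intro n hn
    have h0 : (0 : ℝ) < n := hn ▸ hx0
    have h1 : (n : ℝ) < 1 := hn ▸ hx1
    have h0' : (0 : ℤ) < n := by exact_mod_cast h0
    have h1' : n < (1 : ℤ) := by exact_mod_cast h1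
    omega
  have hS := (Literature.Analysis.SpecialFunctions.hasSum_pi_mul_cot_sub_inv hxZ).tendsto_sum_nat
  have hid : ∀ M : ℕ, ∑ n ∈ Finset.range M, (1 / ((n : ℝ) + x) - 1 / ((n : ℝ) + 1 - x)) =
      1 / x - 1 / (x + M) + ∑ n ∈ Finset.range M, (1 / (x - (n + 1)) + 1 / (x + (n + 1))) := by
    intro M
    induction M with
    | zero => simp
    | succ M ih =>
      rw [Finset.sum_range_succ, Finset.sum_range_succ, ih]
      push_cast
      have hM : (0 : ℝ) ≤ M := Nat.cast_nonneg M
      have h1 : (M : ℝ) + 1 - x ≠ 0 := by linarith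
      have h2 : x - ((M : ℝ) + 1) ≠ 0 := by linarith
      have h3 : x + M ≠ 0 := by positivity
      have h4 : x + ((M : ℝ) + 1) ≠ 0 := by positivity
      have h5 : (M : ℝ) + x ≠ 0 := by positivity
      have hx : x ≠ 0 := hx0.ne'
      field_simp
      ring
  simp_rw [hid]
  have hlim1 : Filter.Tendsto (fun M : ℕ => 1 / x - 1 / (x + M)) Filter.atTop (nhds (1 / x - 0)) := by
    refine tendsto_const_nhds.sub ?_
    have : Filter.Tendsto (fun M : ℕ => x + (M : ℝ)) Filter.atTop Filter.atTop :=
      Filter.tendsto_atTop_add_const_left _ _ tendsto_natCast_atTop_atTop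
    exact tendsto_const_nhds.div_atTop this
  have := hlim1.add hS
  convert this using 2
  ring

/-- Stirling: `N log N − log N! = N − ½ log(2N) − log s_N` (`s_N` = `Stirling.stirlingSeq N`, `N ≥ 1`). -/
theorem mul_log_sub_log_factorial_eq {N : ℕ} (hN : 0 < N) :
    (N : ℝ) * Real.log N - Real.log (N.factorial) =
      N - 1 / 2 * Real.log (2 * N) - Real.log (Stirling.stirlingSeq N) := by
  have hN' : (0 : ℝ) < N := by exact_mod_cast hN
  rw [Stirling.log_stirlingSeq_formula, Real.log_div hN'.ne' (Real.exp_pos 1).ne', Real.log_exp]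
  ring

/-- The same along `N = nM`, with the casts split: `nM log(nM) − log (nM)! = nM − ½ log(2nM) − log s_{nM}`. -/
theorem mul_log_sub_log_factorial_eq' {n M : ℕ} (hn : 0 < n) (hM : 0 < M) :
    (n : ℝ) * M * Real.log ((n : ℝ) * M) - Real.log ((n * M).factorial) =
      (n : ℝ) * M - 1 / 2 * Real.log (2 * ((n : ℝ) * M)) - Real.log (Stirling.stirlingSeq (n * M)) := by
  have h := mul_log_sub_log_factorial_eq (Nat.mul_pos hn hM)
  push_cast at h
  exact h

/-- `H_{nM−1} − log(nM) → γ` along `M → ∞` (`n ≥ 1`). -/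
theorem tendsto_harmonic_mul_sub_log {n : ℕ} (hn : 0 < n) :
    Filter.Tendsto (fun M : ℕ => (harmonic (n * M - 1) : ℝ) - Real.log ((n : ℝ) * M)) Filter.atTop
      (nhds Real.eulerMascheroniConstant) := by
  have hsub : Filter.Tendsto (fun M : ℕ => n * M - 1) Filter.atTop Filter.atTop :=
    Filter.tendsto_atTop_mono (fun M => Nat.sub_le_sub_right (Nat.le_mul_of_pos_left M hn) 1)
      (Filter.tendsto_sub_atTop_nat 1)
  refine (Real.tendsto_harmonic_sub_log_add_one.comp hsub).congr' ?_
  filter_upwards [Filter.eventually_ge_atTop 1] with M hM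
  have h1 : 1 ≤ n * M := Nat.one_le_iff_ne_zero.mpr (Nat.mul_ne_zero hn.ne' (by omega))
  simp only [Function.comp_apply]
  rw [Nat.cast_sub h1]
  push_cast
  ring_nf

/-- `log s_{nM} → ½ log π` along `M → ∞` (`n ≥ 1`). -/
theorem tendsto_log_stirlingSeq_mul {n : ℕ} (hn : 0 < n) :
    Filter.Tendsto (fun M : ℕ => Real.log (Stirling.stirlingSeq (n * M))) Filter.atTop
      (nhds (Real.log Real.pi / 2)) := by
  have hmul : Filter.Tendsto (fun M : ℕ => n * M) Filter.atTop Filter.atTop :=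
    Filter.tendsto_atTop_mono (fun M => Nat.le_mul_of_pos_left M hn) Filter.tendsto_id
  rw [← Real.log_sqrt Real.pi_pos.le]
  exact ((Real.continuousAt_log (Real.sqrt_pos.2 Real.pi_pos).ne').tendsto.comp
    Stirling.tendsto_stirlingSeq_sqrt_pi).comp hmul

/-- The fractional sum in limit-ready form (`M ≥ 1`):
`q Σ_{k<qM} {pk/q}/k = ½(qH_{qM−1} − H_{M−1}) + ½ Σ_{r<q} {pr/q}·D_M(r/q)`. -/
theorem fract_sum_eq_half {p q M : ℕ} (hq : 0 < q) (hpq : Nat.Coprime p q) (hM : 0 < M) :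
    (q : ℝ) * ∑ k ∈ Finset.Ico 1 (q * M), Int.fract ((p : ℝ) * k / q) / k =
      1 / 2 * (q * (harmonic (q * M - 1) : ℝ) - (harmonic (M - 1) : ℝ))
        + 1 / 2 * ∑ r ∈ Finset.Ico 1 q, Int.fract ((p : ℝ) * r / q) *
            ∑ n ∈ Finset.range M, (1 / ((n : ℝ) + (r : ℝ) / q) - 1 / ((n : ℝ) + 1 - (r : ℝ) / q)) := by
  rw [sum_fract_div_eq_sum_residue p hq M]
  have h2 := two_mul_sum_fract_mul_eq hpq (fun r => ∑ n ∈ Finset.range M, (q : ℝ) / ((q : ℝ) * n + r))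
  rw [sum_Ico_sum_range_div_eq hq hM] at h2
  have h3 : ∑ r ∈ Finset.Ico 1 q, Int.fract ((p : ℝ) * r / q) *
      (∑ n ∈ Finset.range M, (q : ℝ) / ((q : ℝ) * n + r) - ∑ n ∈ Finset.range M, (q : ℝ) / ((q : ℝ) * n + ↑(q - r))) =
      ∑ r ∈ Finset.Ico 1 q, Int.fract ((p : ℝ) * r / q) *
        ∑ n ∈ Finset.range M, (1 / ((n : ℝ) + (r : ℝ) / q) - 1 / ((n : ℝ) + 1 - (r : ℝ) / q)) := by
    refine Finset.sum_congr rfl fun r hr => ?_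
    rw [sum_range_div_sub_div_eq hq hr]
  rw [h3] at h2
  linarith

/-- **The limit of the finite master identity's right-hand side.** -/
theorem tendsto_master_rhs {p q : ℕ} (hp : 0 < p) (hq : 0 < q) (hpq : Nat.Coprime p q) :
    Filter.Tendsto (fun M : ℕ =>
      2 * (p : ℝ) * q * M
        - p * ((q : ℝ) * M * Real.log ((q : ℝ) * M) - Real.log ((q * M).factorial))
        - q * ((p : ℝ) * M * Real.log ((p : ℝ) * M) - Real.log ((p * M).factorial))
        - ∑ m ∈ Finset.Ico 1 M, 1 / (m : ℝ) - 1 / M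
        - q * ∑ k ∈ Finset.Ico 1 (q * M), Int.fract ((p : ℝ) * k / q) / k
        - p * ∑ j ∈ Finset.Ico 1 (p * M), Int.fract ((q : ℝ) * j / p) / j) Filter.atTop
      (nhds ((((q : ℝ) - p) / 2) * (Real.log p - Real.log q)
        + (((p : ℝ) + q) / 2) * (Real.log 2 + Real.log Real.pi - Real.eulerMascheroniConstant)
        - Real.pi / 2 * (∑ r ∈ Finset.Ico 1 q, Int.fract ((p : ℝ) * r / q) * Real.cot (Real.pi * ((r : ℝ) / q))
            + ∑ j ∈ Finset.Ico 1 p, Int.fract ((q : ℝ) * j / p) * Real.cot (Real.pi * ((j : ℝ) / p))))) := by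
  have hp' : (0 : ℝ) < p := by exact_mod_cast hp
  have hq' : (0 : ℝ) < q := by exact_mod_cast hq
  -- the limit-able pieces
  set Dq : ℕ → ℝ := fun M => ∑ r ∈ Finset.Ico 1 q, Int.fract ((p : ℝ) * r / q) *
      ∑ n ∈ Finset.range M, (1 / ((n : ℝ) + (r : ℝ) / q) - 1 / ((n : ℝ) + 1 - (r : ℝ) / q)) with hDq
  set Dp : ℕ → ℝ := fun M => ∑ j ∈ Finset.Ico 1 p, Int.fract ((q : ℝ) * j / p) *
      ∑ n ∈ Finset.range M, (1 / ((n : ℝ) + (j : ℝ) / p) - 1 / ((n : ℝ) + 1 - (j : ℝ) / p)) with hDp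
  set C0 : ℝ := (((p : ℝ) + q) / 2) * Real.log 2 + (((q : ℝ) - p) / 2) * (Real.log p - Real.log q) with hC0
  have hnice : ∀ᶠ M : ℕ in Filter.atTop,
      C0 - q / 2 * ((harmonic (q * M - 1) : ℝ) - Real.log ((q : ℝ) * M))
        - p / 2 * ((harmonic (p * M - 1) : ℝ) - Real.log ((p : ℝ) * M))
        + p * Real.log (Stirling.stirlingSeq (q * M)) + q * Real.log (Stirling.stirlingSeq (p * M))
        - 1 / M - 1 / 2 * Dq M - 1 / 2 * Dp M =
      2 * (p : ℝ) * q * M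
        - p * ((q : ℝ) * M * Real.log ((q : ℝ) * M) - Real.log ((q * M).factorial))
        - q * ((p : ℝ) * M * Real.log ((p : ℝ) * M) - Real.log ((p * M).factorial))
        - ∑ m ∈ Finset.Ico 1 M, 1 / (m : ℝ) - 1 / M
        - q * ∑ k ∈ Finset.Ico 1 (q * M), Int.fract ((p : ℝ) * k / q) / k
        - p * ∑ j ∈ Finset.Ico 1 (p * M), Int.fract ((q : ℝ) * j / p) / j := by
    filter_upwards [Filter.eventually_ge_atTop 1] with M hM
    have hM0 : 0 < M := by omega
    have hM' : (0 : ℝ) < M := by exact_mod_cast hM0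
    rw [fract_sum_eq_half hq hpq hM0, fract_sum_eq_half hp hpq.symm hM0, sum_Ico_one_div_eq_harmonic hM0,
      mul_log_sub_log_factorial_eq' hq hM0, mul_log_sub_log_factorial_eq' hp hM0]
    have hl1 : Real.log (2 * ((q : ℝ) * M)) = Real.log 2 + Real.log q + Real.log M := by
      rw [Real.log_mul (by norm_num) (by positivity), Real.log_mul hq'.ne' hM'.ne']
      ring
    have hl2 : Real.log (2 * ((p : ℝ) * M)) = Real.log 2 + Real.log p + Real.log M := by
      rw [Real.log_mul (by norm_num) (by positivity), Real.log_mul hp'.ne' hM'.ne']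
      ring
    have hl3 : Real.log ((q : ℝ) * M) = Real.log q + Real.log M := Real.log_mul hq'.ne' hM'.ne'
    have hl4 : Real.log ((p : ℝ) * M) = Real.log p + Real.log M := Real.log_mul hp'.ne' hM'.ne'
    rw [hl1, hl2, hl3, hl4]
    simp only [hC0, hDq, hDp]
    ring
  -- limits of the pieces
  have tq := tendsto_harmonic_mul_sub_log hq (n := q)
  have tp := tendsto_harmonic_mul_sub_log hp (n := p)
  have sq := tendsto_log_stirlingSeq_mul hq (n := q)
  have sp := tendsto_log_stirlingSeq_mul hp (n := p)
  have tM : Filter.Tendsto (fun M : ℕ => 1 / (M : ℝ)) Filter.atTop (nhds 0) := tendsto_const_div_atTop_nhds_zero_nat 1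
  have tDq : Filter.Tendsto Dq Filter.atTop
      (nhds (Real.pi * ∑ r ∈ Finset.Ico 1 q, Int.fract ((p : ℝ) * r / q) * Real.cot (Real.pi * ((r : ℝ) / q)))) := by
    rw [Finset.mul_sum]
    refine tendsto_finsetSum _ fun r hr => ?_
    rw [Finset.mem_Ico] at hr
    have h0 : (0 : ℝ) < (r : ℝ) / q := by
      have : (0 : ℝ) < r := by exact_mod_cast hr.1
      positivity
    have h1 : (r : ℝ) / q < 1 := by
      rw [div_lt_one hq']; exact_mod_cast hr.2
    have h := (tendsto_sum_one_div_sub_one_div h0 h1).const_mul (Int.fract ((p : ℝ) * r / q))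
    rw [show Real.pi * (Int.fract ((p : ℝ) * r / q) * Real.cot (Real.pi * ((r : ℝ) / q)))
      = Int.fract ((p : ℝ) * r / q) * (Real.pi * Real.cot (Real.pi * ((r : ℝ) / q))) by ring]
    exact h
  have tDp : Filter.Tendsto Dp Filter.atTop
      (nhds (Real.pi * ∑ j ∈ Finset.Ico 1 p, Int.fract ((q : ℝ) * j / p) * Real.cot (Real.pi * ((j : ℝ) / p)))) := by
    rw [Finset.mul_sum]
    refine tendsto_finsetSum _ fun j hj => ?_
    rw [Finset.mem_Ico] at hj
    have h0 : (0 : ℝ) < (j : ℝ) / p := by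
      have : (0 : ℝ) < j := by exact_mod_cast hj.1
      positivity
    have h1 : (j : ℝ) / p < 1 := by
      rw [div_lt_one hp']; exact_mod_cast hj.2
    have h := (tendsto_sum_one_div_sub_one_div h0 h1).const_mul (Int.fract ((q : ℝ) * j / p))
    rw [show Real.pi * (Int.fract ((q : ℝ) * j / p) * Real.cot (Real.pi * ((j : ℝ) / p)))
      = Int.fract ((q : ℝ) * j / p) * (Real.pi * Real.cot (Real.pi * ((j : ℝ) / p))) by ring]
    exact h
  have hlim := (((((((tendsto_const_nhds (x := C0)).sub (tq.const_mul ((q : ℝ) / 2))).sub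
    (tp.const_mul ((p : ℝ) / 2))).add (sq.const_mul (p : ℝ))).add (sp.const_mul (q : ℝ))).sub tM).sub
      (tDq.const_mul (1 / 2))).sub (tDp.const_mul (1 / 2))
  refine Filter.Tendsto.congr' hnice ?_
  convert hlim using 2
  rw [hC0]
  ring

/-! ## Step 8: from `A(p/q)` to the improper integral, and the conclusion -/

/-- `x ↦ {px}{qx}/x²` is integrable on `(0, ∞)` (bounded by `pq` near `0`, by `x⁻²` at infinity). -/
theorem integrableOn_fract_mul_fract_div_sq (p q : ℕ) :
    IntegrableOn (fun x : ℝ => Int.fract ((p : ℝ) * x) * Int.fract ((q : ℝ) * x) / x ^ 2) (Ioi 0) := by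
  set F : ℝ → ℝ := fun x => Int.fract ((p : ℝ) * x) * Int.fract ((q : ℝ) * x) / x ^ 2 with hF
  have hmeas : Measurable F := by
    have m1 : Measurable (fun x : ℝ => Int.fract ((p : ℝ) * x)) :=
      measurable_fract.comp (measurable_const.mul measurable_id)
    have m2 : Measurable (fun x : ℝ => Int.fract ((q : ℝ) * x)) :=
      measurable_fract.comp (measurable_const.mul measurable_id)
    exact (m1.mul m2).div (measurable_id.pow_const 2)
  have hnn : ∀ x : ℝ, 0 ≤ F x := fun x =>
    div_nonneg (mul_nonneg (Int.fract_nonneg _) (Int.fract_nonneg _)) (sq_nonneg x)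
  have hfract_le : ∀ (n : ℕ) (x : ℝ), 0 ≤ x → Int.fract ((n : ℝ) * x) ≤ (n : ℝ) * x := by
    intro n x hx
    have h0 : 0 ≤ (n : ℝ) * x := by positivity
    rw [← Int.self_sub_floor]
    have : (0 : ℝ) ≤ ⌊(n : ℝ) * x⌋ := by exact_mod_cast Int.floor_nonneg.mpr h0
    linarith
  -- near zero
  have h01 : IntegrableOn F (Ioc 0 1) := by
    have hc : IntegrableOn (fun _ : ℝ => (p : ℝ) * q) (Ioc 0 1) := integrableOn_const (by simp)
    refine hc.mono' hmeas.aestronglyMeasurable ?_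
    refine (ae_restrict_iff' measurableSet_Ioc).mpr (ae_of_all _ fun x hx => ?_)
    rw [Real.norm_of_nonneg (hnn x), hF]
    simp only
    have hx0 : 0 < x := hx.1
    rw [div_le_iff₀ (by positivity)]
    calc Int.fract ((p : ℝ) * x) * Int.fract ((q : ℝ) * x) ≤ ((p : ℝ) * x) * ((q : ℝ) * x) :=
          mul_le_mul (hfract_le p x hx0.le) (hfract_le q x hx0.le) (Int.fract_nonneg _) (by positivity)
      _ = (p : ℝ) * q * x ^ 2 := by ring
  -- at infinity
  have h1i : IntegrableOn F (Ioi 1) := by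
    have hr : IntegrableOn (fun x : ℝ => x ^ (-2 : ℝ)) (Ioi 1) :=
      integrableOn_Ioi_rpow_of_lt (by norm_num) zero_lt_one
    refine hr.mono' hmeas.aestronglyMeasurable ?_
    refine (ae_restrict_iff' measurableSet_Ioi).mpr (ae_of_all _ fun x hx => ?_)
    rw [Real.norm_of_nonneg (hnn x), hF]
    simp only
    have hx0 : 0 < x := lt_trans zero_lt_one hx
    rw [Real.rpow_neg hx0.le, Real.rpow_two, div_eq_mul_inv]
    refine mul_le_of_le_one_left (inv_nonneg.mpr (sq_nonneg x)) ?_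
    calc Int.fract ((p : ℝ) * x) * Int.fract ((q : ℝ) * x) ≤ 1 * 1 :=
          mul_le_mul (Int.fract_lt_one _).le (Int.fract_lt_one _).le (Int.fract_nonneg _) zero_le_one
      _ = 1 := one_mul 1
  have h := h01.union h1i
  rwa [Ioc_union_Ioi_eq_Ioi zero_le_one] at h

/-- `A(p/q) = (1/q)·∫_0^∞ {px}{qx} x⁻² dx` (substitution `t = qx`). -/
theorem fractAutocorr_div_eq (p : ℕ) {q : ℕ} (hq : 0 < q) :
    fractAutocorr ((p : ℝ) / q) =
      1 / q * ∫ x in Ioi (0 : ℝ), Int.fract ((p : ℝ) * x) * Int.fract ((q : ℝ) * x) / x ^ 2 := by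
  have hq' : (0 : ℝ) < q := by exact_mod_cast hq
  unfold fractAutocorr
  set g : ℝ → ℝ := fun t => Int.fract t * Int.fract ((p : ℝ) / q * t) / t ^ 2 with hg
  have h := integral_comp_mul_left_Ioi g 0 hq'
  rw [mul_zero, smul_eq_mul] at h
  have hcongr : ∫ x in Ioi (0 : ℝ), g ((q : ℝ) * x) =
      ∫ x in Ioi (0 : ℝ), 1 / (q : ℝ) ^ 2 * (Int.fract ((p : ℝ) * x) * Int.fract ((q : ℝ) * x) / x ^ 2) := by
    refine setIntegral_congr_fun measurableSet_Ioi fun x hx => ?_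
    have hx0 : x ≠ 0 := ne_of_gt hx
    have hq0 : (q : ℝ) ≠ 0 := hq'.ne'
    simp only [hg]
    rw [show (p : ℝ) / q * ((q : ℝ) * x) = (p : ℝ) * x by field_simp]
    field_simp
  rw [hcongr, integral_const_mul] at h
  have hsolve : ∫ x in Ioi (0 : ℝ), g x = q * ((q : ℝ)⁻¹ * ∫ x in Ioi (0 : ℝ), g x) := by
    rw [← mul_assoc, mul_inv_cancel₀ hq'.ne', one_mul]
  rw [hsolve, ← h, ← mul_assoc]
  congr 1
  have hq0 : (q : ℝ) ≠ 0 := hq'.ne'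
  field_simp

/-- **`∫_0^∞ {px}{qx} x⁻² dx` in closed form** (coprime `p, q ≥ 1`):
`= ((q−p)/2)(log p − log q) + ((p+q)/2)(log 2 + log π − γ) − (π/2)(Σ_r {pr/q} cot(πr/q) + Σ_j {qj/p} cot(πj/p))`. -/
theorem integral_Ioi_fract_mul_fract_div_sq {p q : ℕ} (hp : 0 < p) (hq : 0 < q) (hpq : Nat.Coprime p q) :
    ∫ x in Ioi (0 : ℝ), Int.fract ((p : ℝ) * x) * Int.fract ((q : ℝ) * x) / x ^ 2 =
      (((q : ℝ) - p) / 2) * (Real.log p - Real.log q)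
        + (((p : ℝ) + q) / 2) * (Real.log 2 + Real.log Real.pi - Real.eulerMascheroniConstant)
        - Real.pi / 2 * (∑ r ∈ Finset.Ico 1 q, Int.fract ((p : ℝ) * r / q) * Real.cot (Real.pi * ((r : ℝ) / q))
            + ∑ j ∈ Finset.Ico 1 p, Int.fract ((q : ℝ) * j / p) * Real.cot (Real.pi * ((j : ℝ) / p))) := by
  have h1 := intervalIntegral_tendsto_integral_Ioi 0 (integrableOn_fract_mul_fract_div_sq p q)
    (tendsto_natCast_atTop_atTop (R := ℝ))
  have h2 := (tendsto_master_rhs hp hq hpq).congr' (by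
    filter_upwards [Filter.eventually_ge_atTop 1] with M hM
    exact (integral_fract_mul_fract_eq hp hq hpq (by omega)).symm)
  exact tendsto_nhds_unique h1 h2

end Vasyunin

open Vasyunin in
/-- **BBLS 2003 Prop. 89 = Vasyunin's formula, DISCHARGED (RH-FREE):** for coprime positive integers `p, q` and `λ = p/q`,
`A(λ) = (1−λ)/2·log λ + (λ+1)/2·(log 2π − γ) − (π/(2q))·(V(p,q) + V(q,p))` — the named fact
`Literature.NumberTheory.LFunctions.BBLS2003_prop89` (arXiv:math/0306251 Prop. 89; Vasyunin 1996) is a kernel theorem. -/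
theorem bbls2003_prop89_holds : BBLS2003_prop89 := by
  unfold BBLS2003_prop89
  intro p q hp hq hpq
  have hp' : (0 : ℝ) < p := by exact_mod_cast hp
  have hq' : (0 : ℝ) < q := by exact_mod_cast hq
  have hq0 : (q : ℝ) ≠ 0 := hq'.ne'
  rw [fractAutocorr_div_eq p hq, integral_Ioi_fract_mul_fract_div_sq hp hq hpq,
    Real.log_div hp'.ne' hq'.ne', Real.log_mul two_ne_zero Real.pi_pos.ne']
  have hV1 : vasyuninCotSum ((p : ℕ) : ℤ) q =
      ∑ r ∈ Finset.Ico 1 q, Int.fract ((p : ℝ) * r / q) * Real.cot (Real.pi * ((r : ℝ) / q)) := by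
    unfold vasyuninCotSum
    refine Finset.sum_congr rfl fun r _ => ?_
    push_cast
    congr 1 <;> congr 1 <;> ring
  have hV2 : vasyuninCotSum ((q : ℕ) : ℤ) p =
      ∑ j ∈ Finset.Ico 1 p, Int.fract ((q : ℝ) * j / p) * Real.cot (Real.pi * ((j : ℝ) / p)) := by
    unfold vasyuninCotSum
    refine Finset.sum_congr rfl fun j _ => ?_
    push_cast
    congr 1 <;> congr 1 <;> ring
  rw [hV1, hV2]
  field_simp

/-- **The Nyman–Beurling Gram matrix in closed form, UNCONDITIONAL (RH-FREE):** for `a = j+1`, `b = k+1`,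
`λ = a/b = p/q` in lowest terms, `G_{ab} = [ (1−λ)/2·log λ + (λ+1)/2·(log 2π − γ) − π/(2q)·(V(p,q) + V(q,p)) ] / a` —
`nbGram_eq_vasyunin_of` with Vasyunin's formula discharged: every entry of the object the certified lineages A / R / C2 of
DATA.md §L compute is a kernel closed form. -/
theorem nbGram_eq_vasyunin (j k : ℕ) :
    nbGram j k =
      ((1 - ((j : ℝ) + 1) / ((k : ℝ) + 1)) / 2 * Real.log (((j : ℝ) + 1) / ((k : ℝ) + 1))
        + (((j : ℝ) + 1) / ((k : ℝ) + 1) + 1) / 2 * (Real.log (2 * Real.pi) - Real.eulerMascheroniConstant)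
        - Real.pi / (2 * (((k + 1) / Nat.gcd (j + 1) (k + 1) : ℕ) : ℝ)) *
          (vasyuninCotSum (((j + 1) / Nat.gcd (j + 1) (k + 1) : ℕ) : ℤ) ((k + 1) / Nat.gcd (j + 1) (k + 1))
            + vasyuninCotSum (((k + 1) / Nat.gcd (j + 1) (k + 1) : ℕ) : ℤ) ((j + 1) / Nat.gcd (j + 1) (k + 1))))
        / ((j : ℝ) + 1) :=
  nbGram_eq_vasyunin_of bbls2003_prop89_holds j k

end Summit.RiemannHypothesis.RiemannHypothesis.Theorems.NbTheory

end
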